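import Summits.HodgeConjecture.HodgeConjecture.Theorems.SignSymmetricPowersSymmetricA3Plane
import Summits.HodgeConjecture.HodgeConjecture.Theorems.SignSymmetricPowersSymmetricA3Line
import Literature.AlgebraicGeometry.HodgeTheory.SymmetricA3BifurcationTheorem
import HarnessLib

/-!
# K1-B LINK-F witnesses (route `SignSymmetricPowers`, item stmt-HodgeConjecture-19716) — the bifurcation picture at the
# two symmetric `A₃` witnesses of the ι-even family is UNCONDITIONAL

Prover seat `hodge-nonav-19716-p2` (g8), cell `hodge-nonav`.  Helper file `--supports stmt-HodgeConjecture-19716`;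
sorry-free, no definition, no named fact used.  Combines the cell's explicit symmetric `A₃` data
(`SignSymmetricPowersSymmetricA3Plane.exists_symmetricA3Datum_plane` at `e₄`, Π/pair confluence, and
`SignSymmetricPowersSymmetricA3Line.exists_symmetricA3Datum_line` at `e₀`, L/pair confluence; registered stub
`stub_signConfluenceLinkF` of the K1-B line v12b) with the bifurcation half of F-B2PL, now a theorem
(`Literature.AlgebraicGeometry.HodgeTheory.IsSymmetricA3Datum.exists_isSymmetricA3Bifurcation`, programme B2-BIF):

* `exists_bifurcation_plane`, `exists_bifurcation_line` — for every `n` there are ι-even forms `f₁, g₀, g₂` of degree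
  `2n + 4` on `ℙ⁴` (the split `A₃`-witness and its two even unfolding directions) and `εa, εb > 0`, `ψ` holomorphic,
  such that on `|a| < εa, |b| < εb` the member `f₁ + a g₂ + b g₀` of the ι-even family is nonsingular iff
  `b ∉ {0, ψ(a)}`, the member `b = 0` (`a ≠ 0`) has exactly one node, at the coordinate point, and the member
  `b = ψ(a)` exactly two nodes exchanged by `ι` — i.e. near the `A₃` witness the discriminant of the ι-even family
  consists of the Π-node (resp. L-node) branch and the exchanged-pair branch, meeting at the witness (AGZV II §5.2,
  boundary singularity `B₂`).  UNCONDITIONAL: no Picard–Lefschetz input is used.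

Nothing here says HC ∕ HC_AV is proved; rung F-H1 is not moved.
-/

set_option linter.dupNamespace false

noncomputable section

namespace Summit.HodgeConjecture.HodgeConjecture.Theorems.SignSymmetricPowersSymmetricA3WitnessBifurcation

open MvPolynomial Literature.AlgebraicGeometry.HodgeTheory

/-- **The discriminant of the ι-even family near the `A₃` witness at `e₄` is `b = 0 ∪ b = ψ(a)`** (Π-node branch and
exchanged-pair branch), unconditionally: ι-even forms `f₁, g₀, g₂` of degree `2n + 4` with a symmetric `A₃` datum at
`e₄` AND bifurcation data `IsSymmetricA3Bifurcation f₁ g₀ g₂ 4 ι εa εb ψ`. -/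
theorem exists_bifurcation_plane (n : ℕ) :
    ∃ (f₁ g₀ g₂ : MvPolynomial (Fin 5) ℂ) (εa εb : ℝ) (ψ : ℂ → ℂ),
      f₁.IsHomogeneous (2 * n + 4) ∧ g₀.IsHomogeneous (2 * n + 4) ∧ g₂.IsHomogeneous (2 * n + 4) ∧
      (∀ e : Fin 5 →₀ ℕ, ¬ Even (e 0 + e 1) → f₁.coeff e = 0) ∧
      (∀ e : Fin 5 →₀ ℕ, ¬ Even (e 0 + e 1) → g₀.coeff e = 0) ∧
      (∀ e : Fin 5 →₀ ℕ, ¬ Even (e 0 + e 1) → g₂.coeff e = 0) ∧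
      IsSymmetricA3Datum f₁ g₀ g₂ 4 0 (fun i : Fin 5 => if (i : ℕ) < 2 then (-1 : ℂˣ) else 1) ∧
      IsSymmetricA3Bifurcation f₁ g₀ g₂ 4 (fun i : Fin 5 => if (i : ℕ) < 2 then (-1 : ℂˣ) else 1) εa εb ψ := by
  obtain ⟨f₁, g₀, g₂, hf₁, hg₀, hg₂, he₁, he₀, he₂, hD⟩ :=
    SignSymmetricPowersSymmetricA3Plane.exists_symmetricA3Datum_plane n
  obtain ⟨εa, εb, ψ, hB⟩ := hD.exists_isSymmetricA3Bifurcation hf₁ hg₀ hg₂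
  exact ⟨f₁, g₀, g₂, εa, εb, ψ, hf₁, hg₀, hg₂, he₁, he₀, he₂, hD, hB⟩

/-- **The discriminant of the ι-even family near the `A₃` witness at `e₀` is `b = 0 ∪ b = ψ(a)`** (L-node branch and
exchanged-pair branch), unconditionally. -/
theorem exists_bifurcation_line (n : ℕ) :
    ∃ (f₁ g₀ g₂ : MvPolynomial (Fin 5) ℂ) (εa εb : ℝ) (ψ : ℂ → ℂ),
      f₁.IsHomogeneous (2 * n + 4) ∧ g₀.IsHomogeneous (2 * n + 4) ∧ g₂.IsHomogeneous (2 * n + 4) ∧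
      (∀ e : Fin 5 →₀ ℕ, ¬ Even (e 0 + e 1) → f₁.coeff e = 0) ∧
      (∀ e : Fin 5 →₀ ℕ, ¬ Even (e 0 + e 1) → g₀.coeff e = 0) ∧
      (∀ e : Fin 5 →₀ ℕ, ¬ Even (e 0 + e 1) → g₂.coeff e = 0) ∧
      IsSymmetricA3Datum f₁ g₀ g₂ 0 2 (fun i : Fin 5 => if (i : ℕ) < 2 then (-1 : ℂˣ) else 1) ∧
      IsSymmetricA3Bifurcation f₁ g₀ g₂ 0 (fun i : Fin 5 => if (i : ℕ) < 2 then (-1 : ℂˣ) else 1) εa εb ψ := by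
  obtain ⟨f₁, g₀, g₂, hf₁, hg₀, hg₂, he₁, he₀, he₂, hD⟩ :=
    SignSymmetricPowersSymmetricA3Line.exists_symmetricA3Datum_line n
  obtain ⟨εa, εb, ψ, hB⟩ := hD.exists_isSymmetricA3Bifurcation hf₁ hg₀ hg₂
  exact ⟨f₁, g₀, g₂, εa, εb, ψ, hf₁, hg₀, hg₂, he₁, he₀, he₂, hD, hB⟩

end Summit.HodgeConjecture.HodgeConjecture.Theorems.SignSymmetricPowersSymmetricA3WitnessBifurcation

end
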